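import Summits.Ventures.Crystal3D.Theorems.StickyWulffConstantGenericWallFloorExactOnly
import Literature.Barriers.AtomisticToContinuum.FlexibleKissingArrangements
import HarnessLib

/-!
# Refuting `ExactOnly 0 O` by a kissing dozen that is not close-packed (E2 vocabulary glue)

Helper for `stmt-Ventures-19480` (GenericWallFloor; general-filling step, per-ball programme E1/E2, cf-p1
ROUTE.md §80).  Three lines of glue between the E2 interface `…GenericWallFloorExactOnly` (`ExactOnly`,
`IsKissingAround`, `IsClosePackedDozenAt`) and the kernel-witness files of the cell's literature seat
(`…GenericWallFloorTwistedSquare`, `…TwistedSquareSeven`, `…AdatomRow`, written with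
`Literature.Barriers.AtomisticToContinuum.IsKissingArrangement`): a pattern `O` contained in a twelve-point
kissing arrangement which is not a linear-isometric image of the fcc / hcp pattern is not `ExactOnly 0`
(`not_exactOnly_zero_of_witness`).

WHAT THIS IS NOT: no witness lives here; F-C1 not moved.
-/

noncomputable section

namespace Summit.Ventures.Crystal3D.Theorems

open Literature.Geometry.DiscreteGeometry Literature.Barriers.AtomisticToContinuum

/-- A kissing arrangement (unit vectors, pairwise `≥ 1`) is a kissing arrangement around the origin. -/
theorem isKissingAround_zero_of_isKissingArrangement {N : Finset (EuclideanSpace ℝ (Fin 3))}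
    (h : IsKissingArrangement N) : IsKissingAround 0 N :=
  ⟨fun s hs => by rw [dist_comm, dist_zero_right]; exact h.1 s hs, h.2⟩

/-- A close-packed dozen around the origin is a linear-isometric image of the fcc or of the hcp pattern. -/
theorem exists_isometricImage_of_isClosePackedDozenAt_zero {N : Finset (EuclideanSpace ℝ (Fin 3))}
    (h : IsClosePackedDozenAt 0 N) :
    ∃ A : EuclideanSpace ℝ (Fin 3) →ₗᵢ[ℝ] EuclideanSpace ℝ (Fin 3),
      (↑N : Set (EuclideanSpace ℝ (Fin 3))) = A '' (↑fccKissingPattern : Set (EuclideanSpace ℝ (Fin 3))) ∨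
        (↑N : Set (EuclideanSpace ℝ (Fin 3))) = A '' (↑hcpKissingPattern : Set (EuclideanSpace ℝ (Fin 3))) := by
  obtain ⟨A, hA⟩ := h
  have e : (fun p : EuclideanSpace ℝ (Fin 3) => A p + 0) = ⇑A := funext fun p => add_zero _
  rw [e] at hA
  exact ⟨A, hA⟩

/-- **Witness rule.**  A pattern contained in a twelve-point kissing arrangement that is not a close-packed
dozen is not exact-only around the origin. -/
theorem not_exactOnly_zero_of_witness {O N : Finset (EuclideanSpace ℝ (Fin 3))} (hON : O ⊆ N)
    (hcard : N.card = 12) (hk : IsKissingArrangement N)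
    (hnot : ¬ ∃ A : EuclideanSpace ℝ (Fin 3) →ₗᵢ[ℝ] EuclideanSpace ℝ (Fin 3),
      (↑N : Set (EuclideanSpace ℝ (Fin 3))) = A '' (↑fccKissingPattern : Set (EuclideanSpace ℝ (Fin 3))) ∨
        (↑N : Set (EuclideanSpace ℝ (Fin 3))) = A '' (↑hcpKissingPattern : Set (EuclideanSpace ℝ (Fin 3)))) :
    ¬ ExactOnly 0 O := fun h =>
  hnot (exists_isometricImage_of_isClosePackedDozenAt_zero
    (h N hON hcard (isKissingAround_zero_of_isKissingArrangement hk)))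

end Summit.Ventures.Crystal3D.Theorems

end
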